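import Summits.AtomisticToContinuum.FouriersLaw.Theorems.BondHeatUncertaintyBoundedResponseBathHeatC
import Summits.AtomisticToContinuum.FouriersLaw.Theorems.BondHeatUncertaintySubdiffusiveBondHeatSpectralPositivity
import HarnessLib

/-!
# BondHeatUncertainty / BoundedResponse — «DCBand» addendum «Twist», part A (§T1–§T2a): tools for the `ω`-TWISTED bath heat variance

The addendum PROVES NODE 117's free input: (TV) `TwistedHeatVarNonneg` — `V_N(ω,t) := 2γT²t − 2γ²∫₀ᵗ(t − r)cos(ωr)K_N(r)dr ≥ 0` — as
`V_N(ω,t) = E[(Q^c_t)² + (Q^s_t)²]` for the twisted proxies `Q^c_t + iQ^s_t = ∫₀ᵗ e^{iωs}dQ_s` of NODE 107's bath heat proxy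
`Q_t = ∫₀ᵗ j(z_s)ds + e(z_t) − e(z_0)` (the Stieltjes part defined BY PARTS: `∫₀ᵗcos(ωs)de(z_s) := cos(ωt)e(z_t) − e(z_0) + ω∫₀ᵗsin(ωs)e(z_s)ds`),
hence (FC) `SpectralDeficitNonneg` (`h_N(ω) ≥ 0`: the kinetic spectrum never exceeds the white bath level) by NODE 117's affine Fejér limit.
This part: §T1 integration by parts against a primitive (Fubini on a triangle, no differentiability of the primitive) and the WEIGHTED Dynkin
identity `∫₀ᵗ w'(r)⟪f,P_r e⟫dr = (w(t) − w(0))⟪f,e⟫ + ∫₀ᵗ(w(t) − w(u))⟪f,P_u Le⟫du`; §T2a the two-observable weighted second path moment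
`E[(∫₀ᵗc·f(z))(∫₀ᵗd·g(z))] = ∫∫_{(0,t]²} c(u)d(v)·(u<v ? ⟪f,P_{v−u}g⟫ : ⟪g,P_{u−v}f⟫)` along the stationary constructed flow (extends the tree's
one-observable `pinnedChain_integral_weightedTimeIntegral_mul_of_invariant`).
(decomp-a2c lens-1 g117, NODE 117 «DCBand» addendum; part 1 of 4: TwistA → TwistB → TwistC → DCBandTwist; imports the TREE files
`…BathHeatC` (NODE 107: `kpair`/`spair`, `bathKinCorr`, the `ω = 0` identity) and `…SpectralPositivity` (weighted path integrals))

No `sorry`, no new axioms, no new definitions.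
-/

noncomputable section

open MeasureTheory ProbabilityTheory Filter Topology Set Function
open scoped NNReal ENNReal
open Literature.MathematicalPhysics.KineticTheory.HeatConduction
open Literature.MathematicalPhysics.KineticTheory OscillatorChain
open Literature.Probability.Process
open Summit.AtomisticToContinuum.FouriersLaw.Theorems.SubdiffusiveBondHeat
open Summit.AtomisticToContinuum.FouriersLaw.Theorems.SubdiffusiveBondHeat.EscapeGrading
open Summit.AtomisticToContinuum.FouriersLaw.Theorems.OddSectorIrreversibility

namespace Summit.AtomisticToContinuum.FouriersLaw.Theorems.BoundedResponse.HeatSpreading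

open Summit.AtomisticToContinuum.FouriersLaw.Theses.BondHeatUncertainty (BoundedResponse SubdiffusiveBondHeat)

/-! ## §T1 Scalar tools: integration by parts against a primitive (Fubini on a triangle); the weighted Dynkin identity -/

/-- **Integration by parts against a primitive** (no differentiability of the primitive needed): for `g` bounded measurable,
`w` differentiable with continuous derivative `w'`, and `t ≥ 0`,
`∫₀ᵗ w'(r) (∫₀ʳ g) dr = w(t) ∫₀ᵗ g − ∫₀ᵗ w(u) g(u) du` (Fubini on the triangle `0 < u ≤ r ≤ t` and `∫ᵤᵗ w' = w(t) − w(u)`). [folklore] -/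
theorem integral_deriv_mul_primitive_eq {g w w' : ℝ → ℝ} (hg : Measurable g) {B : ℝ} (hB : ∀ r, |g r| ≤ B)
    (hw : ∀ r, HasDerivAt w (w' r) r) (hw' : Continuous w') {t : ℝ} (ht : 0 ≤ t) :
    ∫ r in (0 : ℝ)..t, w' r * (∫ u in (0 : ℝ)..r, g u) = w t * (∫ u in (0 : ℝ)..t, g u) - ∫ u in (0 : ℝ)..t, w u * g u := by
  -- a bound for `w'` on `[0, t]`
  obtain ⟨W, hW⟩ := isCompact_Icc.exists_bound_of_continuousOn (hw'.continuousOn (s := Icc (0 : ℝ) t))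
  set G : ℝ → ℝ → ℝ := fun r u => w' r * (Iic r).indicator g u with hG
  -- the inner integral with an indicator on the fixed interval `(0, t]`
  have hinner : ∀ r ∈ Ioc 0 t, w' r * (∫ u in (0 : ℝ)..r, g u) = ∫ u in Ioc 0 t, G r u := by
    intro r hr
    have hset : Ioc 0 t ∩ Iic r = Ioc 0 r := by
      ext u
      simp only [mem_Ioc, mem_inter_iff, mem_Iic]
      constructor
      · rintro ⟨⟨h1, -⟩, h2⟩; exact ⟨h1, h2⟩
      · rintro ⟨h1, h2⟩; exact ⟨⟨h1, h2.trans hr.2⟩, h2⟩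
    simp only [hG]
    rw [MeasureTheory.integral_const_mul, setIntegral_indicator measurableSet_Iic, hset, intervalIntegral.integral_of_le hr.1.le]
  rw [intervalIntegral.integral_of_le ht, setIntegral_congr_fun measurableSet_Ioc hinner]
  -- Fubini on `(0,t]²`
  have hGm : Measurable (Function.uncurry G) := by
    have h1 : Function.uncurry G = fun p : ℝ × ℝ => w' p.1 * (if p.2 ≤ p.1 then g p.2 else 0) := by
      funext p
      simp only [Function.uncurry, hG, Set.indicator_apply, mem_Iic]
    rw [h1]
    exact (hw'.measurable.comp measurable_fst).mul
      (Measurable.ite (measurableSet_le measurable_snd measurable_fst) (hg.comp measurable_snd) measurable_const)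
  have hfin : ((volume : Measure ℝ).prod volume) (Ioc (0 : ℝ) t ×ˢ Ioc (0 : ℝ) t) < ∞ := by
    rw [Measure.prod_prod]
    exact ENNReal.mul_lt_top measure_Ioc_lt_top measure_Ioc_lt_top
  have hGi : Integrable (Function.uncurry G)
      (((volume : Measure ℝ).restrict (Ioc 0 t)).prod ((volume : Measure ℝ).restrict (Ioc 0 t))) := by
    rw [Measure.prod_restrict]
    haveI : IsFiniteMeasure (((volume : Measure ℝ).prod volume).restrict (Ioc (0 : ℝ) t ×ˢ Ioc (0 : ℝ) t)) :=
      isFiniteMeasure_restrict.2 hfin.ne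
    refine Integrable.of_bound hGm.aestronglyMeasurable (W * |B|) ?_
    filter_upwards [ae_restrict_mem (measurableSet_Ioc.prod measurableSet_Ioc)] with p hp
    rw [Set.mem_prod] at hp
    obtain ⟨⟨hp1, hp1'⟩, -⟩ := hp
    have h1 : |w' p.1| ≤ W := by simpa only [Real.norm_eq_abs] using hW p.1 ⟨hp1.le, hp1'⟩
    have hW0 : 0 ≤ W := (abs_nonneg _).trans h1
    simp only [Function.uncurry, hG, Set.indicator_apply, mem_Iic, Real.norm_eq_abs]
    split_ifs
    · rw [abs_mul]
      exact mul_le_mul h1 ((hB _).trans (le_abs_self B)) (abs_nonneg _) hW0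
    · rw [mul_zero, abs_zero]
      exact mul_nonneg hW0 (abs_nonneg B)
  rw [integral_integral_swap hGi]
  -- the inner integral in `r` for fixed `u ∈ (0, t]`: `∫_{(0,t]} 1_{u ≤ r} w'(r) dr · g(u) = (w t − w u) g(u)`
  have hval : ∀ u ∈ Ioc 0 t, ∫ r in Ioc 0 t, G r u = (w t - w u) * g u := by
    intro u hu
    have h1 : (fun r => G r u) = fun r => (Ici u).indicator w' r * g u := by
      funext r
      simp only [hG, Set.indicator_apply, mem_Iic, mem_Ici]
      split_ifs <;> simp
    have h2 : Ioc 0 t ∩ Ici u = Icc u t := by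
      ext r
      simp only [mem_inter_iff, mem_Ici, mem_Ioc, mem_Icc]
      constructor
      · rintro ⟨⟨-, h3⟩, h4⟩; exact ⟨h4, h3⟩
      · rintro ⟨h4, h3⟩; exact ⟨⟨lt_of_lt_of_le hu.1 h4, h3⟩, h4⟩
    rw [h1, MeasureTheory.integral_mul_const, setIntegral_indicator measurableSet_Ici, h2,
      MeasureTheory.integral_Icc_eq_integral_Ioc, ← intervalIntegral.integral_of_le hu.2,
      intervalIntegral.integral_eq_sub_of_hasDerivAt (fun r _ => hw r) (hw'.intervalIntegrable _ _)]
  rw [setIntegral_congr_fun measurableSet_Ioc hval, ← intervalIntegral.integral_of_le ht]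
  -- `∫₀ᵗ (w t − w u) g(u) du = w t ∫₀ᵗ g − ∫₀ᵗ w g`
  have hwc : Continuous w := continuous_iff_continuousAt.2 fun r => (hw r).continuousAt
  have hgi : IntervalIntegrable g volume 0 t := intervalIntegrable_of_bounded_measurable hg hB 0 t
  have hwg : IntervalIntegrable (fun u => w u * g u) volume 0 t := hgi.continuousOn_mul hwc.continuousOn
  have heq : ∫ u in (0 : ℝ)..t, (w t - w u) * g u = ∫ u in (0 : ℝ)..t, (w t * g u - w u * g u) :=
    intervalIntegral.integral_congr fun u _ => by ring
  rw [heq, intervalIntegral.integral_sub (hgi.const_mul _) hwg, intervalIntegral.integral_const_mul]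

section WeightedDynkin

variable {ω₂ lam β γ : ℝ} (hω : 0 < ω₂) (hl : 0 < lam) (hβ : 0 < β) (hγ : 0 < γ) {N : ℕ} (hN : 1 < N)
  {T : ℝ} (hT : 0 < T)
include hω hl hβ hγ hN hT

omit hN in
/-- `u ↦ ⟪f, P_u h⟫_T` is measurable (tree `pinnedChain_measurable_kernelPairing`). [folklore] -/
theorem measurable_kpair {f h : PhaseSpace N → ℝ} (hfm : Measurable f) (hhm : Measurable h) :
    Measurable (kpair ω₂ lam β γ T N f h) := by
  haveI := pinnedChain_isProbabilityMeasure_gibbsMeasure hω hl.le hβ.le γ N hT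
  unfold kpair
  exact pinnedChain_measurable_kernelPairing hω hl.le hβ.le hγ.le N T T _ hfm hhm

/-- `|⟪f, P_u h⟫_T| ≤ ∫ f² + ∫ h²` (tree `pinnedChain_abs_kernelPairing_le`). [folklore] -/
theorem abs_kpair_le {f h : PhaseSpace N → ℝ} (hfm : Measurable f) (hhm : Measurable h)
    (hf2 : Integrable (fun y => f y ^ 2) ((pinnedChain ω₂ lam β γ).gibbsMeasure N T))
    (hh2 : Integrable (fun y => h y ^ 2) ((pinnedChain ω₂ lam β γ).gibbsMeasure N T)) (u : ℝ) :
    |kpair ω₂ lam β γ T N f h u| ≤ (∫ y, f y ^ 2 ∂((pinnedChain ω₂ lam β γ).gibbsMeasure N T)) +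
      ∫ y, h y ^ 2 ∂((pinnedChain ω₂ lam β γ).gibbsMeasure N T) := by
  haveI := pinnedChain_isProbabilityMeasure_gibbsMeasure hω hl.le hβ.le γ N hT
  unfold kpair
  exact pinnedChain_abs_kernelPairing_le hω hl.le hβ.le hγ.le N T T _ (pinnedChain_hinv_T hω hl hβ hγ hN hT) hfm hhm hf2 hh2 u

/-- **Weighted integrated Dynkin identity**: if `e` satisfies Dynkin's identity with drift `ℓ`, then for every `f ∈ L²(μ_T)`, every weight
`w` with continuous derivative `w'`, and `t ≥ 0`:
`∫₀ᵗ w'(r) ⟪f, P_r e⟫ dr = (w(t) − w(0)) ⟪f, e⟫ + ∫₀ᵗ (w(t) − w(u)) ⟪f, P_u ℓ⟫ du`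
(`⟪f,P_r e⟫ = ⟪f,e⟫ + ∫₀ʳ⟪f,P ℓ⟫` and `integral_deriv_mul_primitive_eq`). [folklore] -/
theorem integral_deriv_mul_kpair_eq_of_dynkin {f e ℓ : PhaseSpace N → ℝ} (hfm : Measurable f) (hem : Measurable e)
    (hℓm : Measurable ℓ) (hf2 : Integrable (fun y => f y ^ 2) ((pinnedChain ω₂ lam β γ).gibbsMeasure N T))
    (he2 : Integrable (fun y => e y ^ 2) ((pinnedChain ω₂ lam β γ).gibbsMeasure N T))
    (hℓ2 : Integrable (fun y => ℓ y ^ 2) ((pinnedChain ω₂ lam β γ).gibbsMeasure N T))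
    (hdyn : ∀ (r : ℝ≥0) (z : PhaseSpace N),
      ∫ y, e y ∂((pinnedChain ω₂ lam β γ).transitionKernel N T T r z) - e z =
        ∫ s in (0 : ℝ)..(r : ℝ), ∫ y, ℓ y ∂((pinnedChain ω₂ lam β γ).transitionKernel N T T s.toNNReal z))
    {w w' : ℝ → ℝ} (hw : ∀ r, HasDerivAt w (w' r) r) (hw' : Continuous w') {t : ℝ} (ht : 0 ≤ t) :
    ∫ r in (0 : ℝ)..t, w' r * kpair ω₂ lam β γ T N f e r =
      (w t - w 0) * spair ω₂ lam β γ T N f e + ∫ u in (0 : ℝ)..t, (w t - w u) * kpair ω₂ lam β γ T N f ℓ u := by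
  have hpt : ∀ r ∈ uIcc (0 : ℝ) t, w' r * kpair ω₂ lam β γ T N f e r =
      w' r * spair ω₂ lam β γ T N f e + w' r * ∫ u in (0 : ℝ)..r, kpair ω₂ lam β γ T N f ℓ u := by
    intro r hr
    rw [uIcc_of_le ht] at hr
    have h := kpair_dynkin hω hl hβ hγ hN hT hfm hem hℓm hf2 he2 hℓ2 hdyn hr.1
    rw [← mul_add, ← h]
    ring
  have hKm := measurable_kpair hω hl hβ hγ hT hfm hℓm
  have hKb := abs_kpair_le hω hl hβ hγ hN hT hfm hℓm hf2 hℓ2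
  have hprim : Continuous fun r => ∫ u in (0 : ℝ)..r, kpair ω₂ lam β γ T N f ℓ u :=
    intervalIntegral.continuous_primitive (fun a b => intervalIntegrable_of_bounded_measurable hKm hKb a b) 0
  have hwc : Continuous w := continuous_iff_continuousAt.2 fun r => (hw r).continuousAt
  have i1 : IntervalIntegrable (fun r => w' r * spair ω₂ lam β γ T N f e) volume 0 t :=
    (hw'.mul continuous_const).intervalIntegrable _ _
  have i2 : IntervalIntegrable (fun r => w' r * ∫ u in (0 : ℝ)..r, kpair ω₂ lam β γ T N f ℓ u) volume 0 t :=
    (hw'.mul hprim).intervalIntegrable _ _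
  rw [intervalIntegral.integral_congr hpt, intervalIntegral.integral_add i1 i2, intervalIntegral.integral_mul_const,
    intervalIntegral.integral_eq_sub_of_hasDerivAt (fun r _ => hw r) (hw'.intervalIntegrable _ _),
    integral_deriv_mul_primitive_eq hKm hKb hw hw' ht]
  have i3 : IntervalIntegrable (kpair ω₂ lam β γ T N f ℓ) volume 0 t := intervalIntegrable_of_bounded_measurable hKm hKb 0 t
  have i4 : IntervalIntegrable (fun u => w u * kpair ω₂ lam β γ T N f ℓ u) volume 0 t := i3.continuousOn_mul hwc.continuousOn
  have heq : ∫ u in (0 : ℝ)..t, (w t - w u) * kpair ω₂ lam β γ T N f ℓ u =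
      ∫ u in (0 : ℝ)..t, (w t * kpair ω₂ lam β γ T N f ℓ u - w u * kpair ω₂ lam β γ T N f ℓ u) :=
    intervalIntegral.integral_congr fun u _ => by ring
  rw [heq, intervalIntegral.integral_sub (i3.const_mul _) i4, intervalIntegral.integral_const_mul]

end WeightedDynkin


/-! ## §T2 Weighted path moments along the stationary constructed flow (two observables, trigonometric weights) -/

section PathMoments

variable {ω₂ lam β γ : ℝ} (hω : 0 < ω₂) (hl : 0 < lam) (hβ : 0 < β) (hγ : 0 < γ) {N : ℕ} (hN : 1 < N)
  {T : ℝ} (hT : 0 < T)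
include hω hl hβ hγ hN hT

/-- Integrability of the product of two WEIGHTED time integrals `(∫₀ᵗ c f(z_s))(∫₀ᵗ d g(z_s))` along the stationary flow
(`f, g ∈ L²(μ_T)`, measurable weights `|c|, |d| ≤ 1`, `t ≥ 0`). [folklore] -/
theorem pinnedChain_integrable_weightedIntegral_mul {f g : PhaseSpace N → ℝ} (hfm : Measurable f) (hgm : Measurable g)
    (hf2 : Integrable (fun y => f y ^ 2) ((pinnedChain ω₂ lam β γ).gibbsMeasure N T))
    (hg2 : Integrable (fun y => g y ^ 2) ((pinnedChain ω₂ lam β γ).gibbsMeasure N T))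
    {c d : ℝ → ℝ} (hc : Measurable c) (hd : Measurable d) (hcb : ∀ s, |c s| ≤ 1) (hdb : ∀ s, |d s| ≤ 1)
    {t : ℝ} (ht : 0 ≤ t) :
    Integrable (fun p : PhaseSpace N × WienerPair =>
      (∫ s in (0 : ℝ)..t, c s * f ((pinnedChain ω₂ lam β γ).solMap N T T s p.1 (pairPath p.2))) *
        (∫ s in (0 : ℝ)..t, d s * g ((pinnedChain ω₂ lam β γ).solMap N T T s p.1 (pairPath p.2))))
      (((pinnedChain ω₂ lam β γ).gibbsMeasure N T).prod wienerPair) := by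
  haveI := pinnedChain_isProbabilityMeasure_gibbsMeasure hω hl.le hβ.le γ N hT
  have hinv := pinnedChain_hinv_T hω hl hβ hγ hN hT
  have hZ := pinnedChain_measurable_solMap_process hω hl.le hβ.le hγ.le N T T
  have hGi := pinnedChain_integrable_uncurry_timeSquare_of_invariant hω hl.le hβ.le hγ.le N T T _ hinv hfm hgm hf2 hg2 t
  have hWm : Measurable (Function.uncurry fun (p : PhaseSpace N × WienerPair) (z : ℝ × ℝ) =>
      (c z.1 * f ((pinnedChain ω₂ lam β γ).solMap N T T z.1 p.1 (pairPath p.2))) *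
        (d z.2 * g ((pinnedChain ω₂ lam β γ).solMap N T T z.2 p.1 (pairPath p.2)))) := by
    have h1 : Measurable fun w : (PhaseSpace N × WienerPair) × (ℝ × ℝ) => (w.2.1, w.1) :=
      (measurable_fst.comp measurable_snd).prodMk measurable_fst
    have h2 : Measurable fun w : (PhaseSpace N × WienerPair) × (ℝ × ℝ) => (w.2.2, w.1) :=
      (measurable_snd.comp measurable_snd).prodMk measurable_fst
    have hA := hfm.comp (hZ.comp h1)
    have hB := hgm.comp (hZ.comp h2)
    have hc' : Measurable fun w : (PhaseSpace N × WienerPair) × (ℝ × ℝ) => c w.2.1 :=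
      hc.comp (measurable_fst.comp measurable_snd)
    have hd' : Measurable fun w : (PhaseSpace N × WienerPair) × (ℝ × ℝ) => d w.2.2 :=
      hd.comp (measurable_snd.comp measurable_snd)
    exact (hc'.mul hA).mul (hd'.mul hB)
  have hWi : Integrable (Function.uncurry fun (p : PhaseSpace N × WienerPair) (z : ℝ × ℝ) =>
      (c z.1 * f ((pinnedChain ω₂ lam β γ).solMap N T T z.1 p.1 (pairPath p.2))) *
        (d z.2 * g ((pinnedChain ω₂ lam β γ).solMap N T T z.2 p.1 (pairPath p.2))))
      ((((pinnedChain ω₂ lam β γ).gibbsMeasure N T).prod wienerPair).prod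
        (((volume : Measure ℝ).restrict (Ioc 0 t)).prod ((volume : Measure ℝ).restrict (Ioc 0 t)))) := by
    refine hGi.mono hWm.aestronglyMeasurable (Eventually.of_forall fun w => ?_)
    simp only [Function.uncurry, Real.norm_eq_abs, abs_mul]
    have h1 := hcb w.2.1
    have h2 := hdb w.2.2
    have hA := abs_nonneg (f ((pinnedChain ω₂ lam β γ).solMap N T T w.2.1 w.1.1 (pairPath w.1.2)))
    have hB := abs_nonneg (g ((pinnedChain ω₂ lam β γ).solMap N T T w.2.2 w.1.1 (pairPath w.1.2)))
    calc |c w.2.1| * |f ((pinnedChain ω₂ lam β γ).solMap N T T w.2.1 w.1.1 (pairPath w.1.2))| *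
          (|d w.2.2| * |g ((pinnedChain ω₂ lam β γ).solMap N T T w.2.2 w.1.1 (pairPath w.1.2))|)
        ≤ 1 * |f ((pinnedChain ω₂ lam β γ).solMap N T T w.2.1 w.1.1 (pairPath w.1.2))| *
          (1 * |g ((pinnedChain ω₂ lam β γ).solMap N T T w.2.2 w.1.1 (pairPath w.1.2))|) := by
          gcongr
      _ = _ := by ring
  refine hWi.integral_prod_left.congr (Eventually.of_forall fun p => ?_)
  simp only [Function.uncurry]
  rw [intervalIntegral.integral_of_le ht, intervalIntegral.integral_of_le ht]
  exact integral_prod_mul (μ := (volume : Measure ℝ).restrict (Ioc 0 t)) (ν := (volume : Measure ℝ).restrict (Ioc 0 t))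
    (fun s => c s * f ((pinnedChain ω₂ lam β γ).solMap N T T s p.1 (pairPath p.2)))
    (fun s => d s * g ((pinnedChain ω₂ lam β γ).solMap N T T s p.1 (pairPath p.2)))

/-- **Weighted second moments, two observables**: for `f, g ∈ L²(μ_T)`, measurable weights `|c|, |d| ≤ 1` and `t ≥ 0`,
`E[(∫₀ᵗ c(s) f(z_s) ds)(∫₀ᵗ d(s) g(z_s) ds)] = ∫∫_{(0,t]²} c(u) d(v) C_{fg}(u,v) du dv` with the two-time law
`C_{fg}(u,v) = ⟪f, P_{v−u} g⟫` for `u < v` and `⟪g, P_{u−v} f⟫` for `v ≤ u` (generalises the tree's one-observable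
`pinnedChain_integral_weightedTimeIntegral_mul_of_invariant`). [folklore] -/
theorem pinnedChain_integral_weightedIntegral_mul_eq {f g : PhaseSpace N → ℝ} (hfm : Measurable f) (hgm : Measurable g)
    (hf2 : Integrable (fun y => f y ^ 2) ((pinnedChain ω₂ lam β γ).gibbsMeasure N T))
    (hg2 : Integrable (fun y => g y ^ 2) ((pinnedChain ω₂ lam β γ).gibbsMeasure N T))
    {c d : ℝ → ℝ} (hc : Measurable c) (hd : Measurable d) (hcb : ∀ s, |c s| ≤ 1) (hdb : ∀ s, |d s| ≤ 1)
    {t : ℝ} (ht : 0 ≤ t) :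
    ∫ p, (∫ s in (0 : ℝ)..t, c s * f ((pinnedChain ω₂ lam β γ).solMap N T T s p.1 (pairPath p.2))) *
        (∫ s in (0 : ℝ)..t, d s * g ((pinnedChain ω₂ lam β γ).solMap N T T s p.1 (pairPath p.2)))
        ∂(((pinnedChain ω₂ lam β γ).gibbsMeasure N T).prod wienerPair) =
      ∫ z in Ioc 0 t ×ˢ Ioc 0 t, c z.1 * d z.2 *
        (if z.1 < z.2 then kpair ω₂ lam β γ T N f g (z.2 - z.1) else kpair ω₂ lam β γ T N g f (z.1 - z.2))
        ∂(volume.prod volume) := by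
  haveI := pinnedChain_isProbabilityMeasure_gibbsMeasure hω hl.le hβ.le γ N hT
  have hinv := pinnedChain_hinv_T hω hl hβ hγ hN hT
  haveI hLfin : IsFiniteMeasure ((volume : Measure ℝ).restrict (Ioc 0 t)) := by
    refine ⟨?_⟩
    rw [Measure.restrict_apply_univ]
    exact measure_Ioc_lt_top
  have hZ := pinnedChain_measurable_solMap_process hω hl.le hβ.le hγ.le N T T
  -- the two-time law on the square
  have hpair : ∀ u v : ℝ, 0 ≤ u → 0 ≤ v →
      ∫ p, f ((pinnedChain ω₂ lam β γ).solMap N T T u p.1 (pairPath p.2)) *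
          g ((pinnedChain ω₂ lam β γ).solMap N T T v p.1 (pairPath p.2)) ∂(((pinnedChain ω₂ lam β γ).gibbsMeasure N T).prod wienerPair) =
        if u < v then kpair ω₂ lam β γ T N f g (v - u) else kpair ω₂ lam β γ T N g f (u - v) := by
    intro u v hu hv
    by_cases huv : u < v
    · rw [if_pos huv]
      unfold kpair
      exact pinnedChain_integral_mul_solMap_of_invariant hω hl.le hβ.le hγ.le N T T _ hinv hfm hgm hf2 hg2 hu huv.le
    · rw [if_neg huv]
      have heq : ∫ p, f ((pinnedChain ω₂ lam β γ).solMap N T T u p.1 (pairPath p.2)) *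
          g ((pinnedChain ω₂ lam β γ).solMap N T T v p.1 (pairPath p.2)) ∂(((pinnedChain ω₂ lam β γ).gibbsMeasure N T).prod wienerPair) =
          ∫ p, g ((pinnedChain ω₂ lam β γ).solMap N T T v p.1 (pairPath p.2)) *
            f ((pinnedChain ω₂ lam β γ).solMap N T T u p.1 (pairPath p.2)) ∂(((pinnedChain ω₂ lam β γ).gibbsMeasure N T).prod wienerPair) :=
        integral_congr_ae (Eventually.of_forall fun p => mul_comm _ _)
      rw [heq]
      unfold kpair
      exact pinnedChain_integral_mul_solMap_of_invariant hω hl.le hβ.le hγ.le N T T _ hinv hgm hfm hg2 hf2 hv (not_lt.1 huv)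
  -- Step 1: product of weighted time integrals as an integral over the square, path by path
  have hpt : ∀ p : PhaseSpace N × WienerPair,
      (∫ s in (0 : ℝ)..t, c s * f ((pinnedChain ω₂ lam β γ).solMap N T T s p.1 (pairPath p.2))) *
        (∫ s in (0 : ℝ)..t, d s * g ((pinnedChain ω₂ lam β γ).solMap N T T s p.1 (pairPath p.2))) =
      ∫ z, (c z.1 * f ((pinnedChain ω₂ lam β γ).solMap N T T z.1 p.1 (pairPath p.2))) *
          (d z.2 * g ((pinnedChain ω₂ lam β γ).solMap N T T z.2 p.1 (pairPath p.2)))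
        ∂(((volume : Measure ℝ).restrict (Ioc 0 t)).prod ((volume : Measure ℝ).restrict (Ioc 0 t))) := by
    intro p
    rw [intervalIntegral.integral_of_le ht, intervalIntegral.integral_of_le ht]
    exact (integral_prod_mul (μ := (volume : Measure ℝ).restrict (Ioc 0 t))
      (ν := (volume : Measure ℝ).restrict (Ioc 0 t))
      (fun s => c s * f ((pinnedChain ω₂ lam β γ).solMap N T T s p.1 (pairPath p.2)))
      (fun s => d s * g ((pinnedChain ω₂ lam β γ).solMap N T T s p.1 (pairPath p.2)))).symm
  rw [integral_congr_ae (Eventually.of_forall hpt)]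
  -- Step 2: Fubini between `Ω` and the square
  have hGi := pinnedChain_integrable_uncurry_timeSquare_of_invariant hω hl.le hβ.le hγ.le N T T _ hinv hfm hgm hf2 hg2 t
  have hWm : Measurable (Function.uncurry fun (p : PhaseSpace N × WienerPair) (z : ℝ × ℝ) =>
      (c z.1 * f ((pinnedChain ω₂ lam β γ).solMap N T T z.1 p.1 (pairPath p.2))) *
        (d z.2 * g ((pinnedChain ω₂ lam β γ).solMap N T T z.2 p.1 (pairPath p.2)))) := by
    have h1 : Measurable fun w : (PhaseSpace N × WienerPair) × (ℝ × ℝ) => (w.2.1, w.1) :=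
      (measurable_fst.comp measurable_snd).prodMk measurable_fst
    have h2 : Measurable fun w : (PhaseSpace N × WienerPair) × (ℝ × ℝ) => (w.2.2, w.1) :=
      (measurable_snd.comp measurable_snd).prodMk measurable_fst
    have hA := hfm.comp (hZ.comp h1)
    have hB := hgm.comp (hZ.comp h2)
    have hc' : Measurable fun w : (PhaseSpace N × WienerPair) × (ℝ × ℝ) => c w.2.1 :=
      hc.comp (measurable_fst.comp measurable_snd)
    have hd' : Measurable fun w : (PhaseSpace N × WienerPair) × (ℝ × ℝ) => d w.2.2 :=
      hd.comp (measurable_snd.comp measurable_snd)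
    exact (hc'.mul hA).mul (hd'.mul hB)
  have hWi : Integrable (Function.uncurry fun (p : PhaseSpace N × WienerPair) (z : ℝ × ℝ) =>
      (c z.1 * f ((pinnedChain ω₂ lam β γ).solMap N T T z.1 p.1 (pairPath p.2))) *
        (d z.2 * g ((pinnedChain ω₂ lam β γ).solMap N T T z.2 p.1 (pairPath p.2))))
      ((((pinnedChain ω₂ lam β γ).gibbsMeasure N T).prod wienerPair).prod
        (((volume : Measure ℝ).restrict (Ioc 0 t)).prod ((volume : Measure ℝ).restrict (Ioc 0 t)))) := by
    refine hGi.mono hWm.aestronglyMeasurable (Eventually.of_forall fun w => ?_)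
    simp only [Function.uncurry, Real.norm_eq_abs, abs_mul]
    have h1 := hcb w.2.1
    have h2 := hdb w.2.2
    have hA := abs_nonneg (f ((pinnedChain ω₂ lam β γ).solMap N T T w.2.1 w.1.1 (pairPath w.1.2)))
    have hB := abs_nonneg (g ((pinnedChain ω₂ lam β γ).solMap N T T w.2.2 w.1.1 (pairPath w.1.2)))
    calc |c w.2.1| * |f ((pinnedChain ω₂ lam β γ).solMap N T T w.2.1 w.1.1 (pairPath w.1.2))| *
          (|d w.2.2| * |g ((pinnedChain ω₂ lam β γ).solMap N T T w.2.2 w.1.1 (pairPath w.1.2))|)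
        ≤ 1 * |f ((pinnedChain ω₂ lam β γ).solMap N T T w.2.1 w.1.1 (pairPath w.1.2))| *
          (1 * |g ((pinnedChain ω₂ lam β γ).solMap N T T w.2.2 w.1.1 (pairPath w.1.2))|) := by
          gcongr
      _ = _ := by ring
  rw [integral_integral_swap hWi]
  -- Step 3: the inner integral on the square is the weighted two-time law
  have hsq : ∀ z ∈ Ioc (0 : ℝ) t ×ˢ Ioc (0 : ℝ) t,
      ∫ p, (c z.1 * f ((pinnedChain ω₂ lam β γ).solMap N T T z.1 p.1 (pairPath p.2))) *
          (d z.2 * g ((pinnedChain ω₂ lam β γ).solMap N T T z.2 p.1 (pairPath p.2)))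
          ∂(((pinnedChain ω₂ lam β γ).gibbsMeasure N T).prod wienerPair) =
        c z.1 * d z.2 *
          (if z.1 < z.2 then kpair ω₂ lam β γ T N f g (z.2 - z.1) else kpair ω₂ lam β γ T N g f (z.1 - z.2)) := by
    intro z hz
    obtain ⟨⟨hz1, -⟩, ⟨hz2, -⟩⟩ := hz
    rw [← hpair z.1 z.2 hz1.le hz2.le, ← MeasureTheory.integral_const_mul]
    refine integral_congr_ae (Eventually.of_forall fun p => ?_)
    ring
  rw [Measure.prod_restrict, setIntegral_congr_fun (measurableSet_Ioc.prod measurableSet_Ioc) hsq]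

end PathMoments

end Summit.AtomisticToContinuum.FouriersLaw.Theorems.BoundedResponse.HeatSpreading

end
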